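import Literature.Probability.RandomPlanarGeometry.HexSAWObservable
import HarnessLib

/-!
# The vertex relation of the parafermionic observable for general simply connected domains

Topic `Literature/Probability/RandomPlanarGeometry`; first support file for the discharge of the
named fact `Literature.Probability.RandomPlanarGeometry.SAW.DuminilCopinSmirnov2012_lemma1`
(`HexParafermion.lean`). Source: H. Duminil-Copin, S. Smirnov, *The connective constant of the
honeycomb lattice equals `√(2+√2)`*, Ann. of Math. 175 (2012), 1653–1665 (arXiv:1007.0575), §2,
Lemma 1 and its proof (p. 4): "walks visiting the three mid-edges can be grouped in pairs … In
order to evaluate the winding of `γ₁` between `p` and `q` above, we used the fact that `a` is on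
the boundary and `Ω` is simply connected … `c(γ₁) + c(γ₂) = (p-v) e^{-iσW} x_c^ℓ (j λ̄⁴ + j̄ λ⁴)
= 0`".

`HexSAWObservable.lean` proves the vertex relation `HV.vertex_relation` in the coordinate model
`HV` for domains `V` contained in the upper half-plane `{x₁ ≥ 0}` entered through the mid-edge
`a = {wOut, hvOrigin}`; that hypothesis is used only to know that `wOut ∉ V` and that every loop
of a walk has winding number `0` around the face `(1, 0)` to the right of the entrance dart
`wOut → hvOrigin`. This file re-runs the pair cancellation under exactly these two hypotheses
(`hw : wOut ∉ V` and `h₀ : every simple cycle of V has winding number 0 around (1, 0)`), which is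
what "`a ∈ ∂Ω`, `Ω` simply connected" provides in general (`HexParafermionProofs.lean`).

## Contents (namespace `Literature.Probability.RandomPlanarGeometry.SAW.HV`)

* `lw_nbrs_of_not_mem`, `pturn_lw_rev_of_wnd`, `pair_sum_of_wnd`, `sum_clsLoop_eq_zero_of_wnd`:
  the pair cancellation with the half-plane hypothesis replaced by `hw`, `h₀`;
* **`vertex_relation_of_wnd`**: `Σ_{γ ⊂ V : a → p,q,r} c(γ) = 0` for every `v ∈ V`, for any
  finite `V ∌ wOut` all of whose simple cycles have winding number `0` around the face `(1, 0)`.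
-/

noncomputable section

open Finset Literature.Probability.LatticeModels Literature.Probability.Percolation

namespace Literature.Probability.RandomPlanarGeometry.SAW

namespace HV

section Pairs

variable {V : Finset HV} {v : HV}

/-- The neighbours of `v` seen by a loop walk (entrance, first and last vertex of the loop body)
are three distinct neighbours and the entrance is off the loop — version assuming only
`wOut ∉ V`. [cite: DuminilCopinSmirnov2012, proof of Lemma 1] -/
theorem lw_nbrs_of_not_mem (hw : wOut ∉ V) {l₁ l₂ : List HV} (hP : IsMidWalk V (lw l₁ v l₂))
    (hl₂ : l₂ ≠ []) :
    hvGraph.Adj v (lwS l₁) ∧ hvGraph.Adj v (l₂.head hl₂) ∧ hvGraph.Adj v (l₂.getLast hl₂) ∧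
      lwS l₁ ≠ l₂.head hl₂ ∧ l₂.head hl₂ ≠ l₂.getLast hl₂ ∧ lwS l₁ ≠ l₂.getLast hl₂ ∧
      lwS l₁ ∉ v :: l₂ := by
  obtain ⟨hc, hh, hadj, hlV, hnd, hne⟩ :=
    (isMidWalk_cons_append_iff V (l := l₁ ++ v :: l₂) (by simp) v).1 hP
  have h2 := lw_two_le hP
  obtain ⟨h, r, rfl⟩ := List.exists_cons_of_ne_nil hl₂
  have hr : r ≠ [] := by rintro rfl; simp at h2
  simp only [List.head_cons, List.getLast_cons hr]
  have hc2 : (v :: h :: r).IsChain hvGraph.Adj := (List.isChain_append.1 hc).2.1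
  have hvh : hvGraph.Adj v h := (List.isChain_cons_cons.1 hc2).1
  have hgv : hvGraph.Adj (r.getLast hr) v := by
    have : (l₁ ++ v :: h :: r).getLast (by simp) = r.getLast hr := by
      rw [List.getLast_append_of_ne_nil _ (List.cons_ne_nil _ _),
        List.getLast_cons (List.cons_ne_nil _ _), List.getLast_cons hr]
    rw [← this]; exact hadj
  have hsn : lwS l₁ ∉ v :: h :: r := by
    rcases eq_or_ne l₁ [] with rfl | hl₁
    · intro hm
      exact hw (hlV _ (List.mem_append_right _ hm))
    · have hs' : lwS l₁ ∈ l₁ := by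
        rw [lwS, List.getLast_cons hl₁]; exact List.getLast_mem hl₁
      intro hm
      exact (List.nodup_append.1 hnd).2.2 _ hs' _ hm rfl
  have hsv : hvGraph.Adj (lwS l₁) v := by
    rcases eq_or_ne l₁ [] with rfl | hl₁
    · simp only [List.nil_append, List.head?_cons, Option.some.injEq] at hh
      subst hh; exact adj_wOut_hvOrigin
    · rw [lwS, List.getLast_cons hl₁]
      exact (List.isChain_append.1 hc).2.2 _ (by rw [List.getLast?_eq_some_getLast hl₁]; rfl) v
        (by simp)
  have hn2 : (h :: r).Nodup := (List.nodup_cons.1 (List.nodup_append.1 hnd).2.1).2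
  refine ⟨hsv.symm, hvh, hgv.symm, fun e => hsn (by simp [e]), fun e => ?_, fun e => hsn ?_, hsn⟩
  · have : h ∈ r := by rw [e]; exact List.getLast_mem hr
    exact (List.nodup_cons.1 hn2).1 this
  · rw [e]; exact List.mem_cons_of_mem _ (List.mem_cons_of_mem _ (List.getLast_mem hr))

/-- **The windings of the two partners differ by `8 · (π/3) · (∓1)`** (`W(a,q) = W(a,p) - 4π/3`,
`W(a,r) = W(a,p) + 4π/3`), for a domain `V ∌ wOut` all of whose simple cycles have winding number
`0` around the face `(1, 0)` at the entrance: the loop closed up is such a cycle, the entrance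
edge `{s, v}` of the loop is connected to the entrance dart `wOut → hvOrigin` by the initial
segment of the walk, which avoids the loop, so its faces are outside too and the loop lemma
`cturn_eq_neg_six_mul_turn` applies. [cite: DuminilCopinSmirnov2012, proof of Lemma 1 ("we used
the fact that a is on the boundary and Ω is simply connected")] -/
theorem pturn_lw_rev_of_wnd (hw : wOut ∉ V)
    (h₀ : ∀ c : List HV, (∀ x ∈ c, x ∈ V) → IsCyc c → wnd c (1, 0) = 0)
    {l₁ l₂ : List HV} (hP : IsMidWalk V (lw l₁ v l₂)) (hl₂ : l₂ ≠ []) :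
    pturn (lw l₁ v l₂.reverse) = pturn (lw l₁ v l₂) + 8 * turn (lwS l₁) v (l₂.head hl₂) := by
  obtain ⟨hc, hh, hadj, hlV, hnd, hne⟩ :=
    (isMidWalk_cons_append_iff V (l := l₁ ++ v :: l₂) (by simp) v).1 hP
  obtain ⟨hvs, hvh, hvg, hsh, hhg, hsg, hsn⟩ := lw_nbrs_of_not_mem hw hP hl₂
  have h2 := lw_two_le hP
  obtain ⟨h, r, rfl⟩ := List.exists_cons_of_ne_nil hl₂
  have hr : r ≠ [] := by rintro rfl; simp at h2
  simp only [List.head_cons, List.getLast_cons hr] at hvh hvg hsh hhg hsg ⊢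
  set s := lwS l₁ with hs_def
  set g := r.getLast hr with hg_def
  set τ := turn s v h with hτ
  have hc2 : (v :: h :: r).IsChain hvGraph.Adj := (List.isChain_append.1 hc).2.1
  -- the loop is a simple cycle of `V`
  have hlast : (v :: h :: r).getLast (List.cons_ne_nil _ _) = g := by
    rw [List.getLast_cons (List.cons_ne_nil _ _), List.getLast_cons hr]
  have hrl := List.length_pos_of_ne_nil hr
  have hcyc : IsCyc (v :: h :: r) := by
    refine ⟨by simp; omega, (List.nodup_append.1 hnd).2.1, fun d hd => ?_⟩
    rw [cdarts_eq (List.cons_ne_nil _ _), List.mem_append, List.mem_singleton] at hd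
    rcases hd with hd | rfl
    · exact adj_of_mem_pdarts hc2 d hd
    · rw [hlast]; exact hvg.symm
  -- the entrance edge is outside: propagate the winding number from `a` along `w :: l₁ ++ [v]`
  have h0 : wnd (v :: h :: r) (leftFace v s) = 0 := by
    have hQc : (wOut :: (l₁ ++ [v])).IsChain hvGraph.Adj := by
      have e : lw l₁ v (h :: r) = (wOut :: (l₁ ++ [v])) ++ (h :: r ++ [v]) := by simp [lw]
      have hc' := hP.1
      rw [e] at hc'
      exact (List.isChain_append.1 hc').1
    have hQi : ∀ q ∈ (wOut :: (l₁ ++ [v])).tail.dropLast, q ∉ v :: h :: r := by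
      intro q hq
      simp only [List.tail_cons, List.dropLast_concat] at hq
      exact fun hm => (List.nodup_append.1 hnd).2.2 q hq q hm rfl
    have hd : (wOut, (l₁ ++ [v]).head (by simp)) ∈ pdarts (wOut :: (l₁ ++ [v])) := by
      rw [pdarts_cons_of_ne_nil wOut (by simp)]; exact List.mem_cons_self
    have hd' : (s, v) ∈ pdarts (wOut :: (l₁ ++ [v])) := by
      rw [← List.cons_append, pdarts_append_singleton _ (List.cons_ne_nil _ _)]
      exact List.mem_append_right _ (List.mem_singleton_self _)
    have key := wnd_rightFace_pdarts_eq hcyc.2.2 _ hQc hQi _ hd _ hd'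
    have hO : (l₁ ++ [v]).head (by simp) = hvOrigin := by
      rcases eq_or_ne l₁ [] with rfl | hl₁
      · simpa using hh
      · rw [List.head_append_of_ne_nil hl₁]
        rw [List.head?_append_of_ne_nil _ hl₁] at hh
        exact (List.head_eq_iff_head?_eq_some hl₁).2 hh
    simp only [hO, show rightFace wOut hvOrigin = (1, 0) by decide] at key
    have hz : wnd (v :: h :: r) (1, 0) = 0 :=
      h₀ _ (fun w hw' => hlV w (List.mem_append_right _ hw')) hcyc
    rw [hz] at key
    exact key.symm
  have hct : cturn (v :: h :: r) = -6 * τ :=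
    cturn_eq_neg_six_mul_turn hcyc (List.cons_ne_nil _ _) hvs hsn h0
  -- turns at `v`
  have t1 : turn g v h = -τ := turn_eq_neg_turn hvs hvh hvg hsh hhg hsg
  have t2 : turn s v g = -τ := turn_eq_neg_turn' hvs hvh hvg hsh hhg hsg
  -- splitting the turn sums
  have e1 : pturn (lw l₁ v (h :: r)) =
      pturn (wOut :: l₁ ++ [v, h]) + pturn (v :: h :: r ++ [v]) := by
    have : lw l₁ v (h :: r) = (wOut :: l₁) ++ v :: h :: (r ++ [v]) := by simp [lw]
    rw [this, pturn_append_cons_cons]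
    simp
  have er : (h :: r).reverse = g :: (r.dropLast.reverse ++ [h]) := by
    conv_lhs => rw [← List.dropLast_append_getLast hr]
    simp [hg_def]
  have e2 : pturn (lw l₁ v (h :: r).reverse) =
      pturn (wOut :: l₁ ++ [v, g]) + pturn (v :: (h :: r).reverse ++ [v]) := by
    have : lw l₁ v (h :: r).reverse =
        (wOut :: l₁) ++ v :: g :: ((r.dropLast.reverse ++ [h]) ++ [v]) := by
      simp [lw, er]
    rw [this, pturn_append_cons_cons, er]
    simp
  have e3 : pturn (wOut :: l₁ ++ [v, h]) = pturn (wOut :: l₁ ++ [v]) + τ :=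
    pturn_concat_turn (wOut :: l₁) (List.cons_ne_nil _ _) v h
  have e4 : pturn (wOut :: l₁ ++ [v, g]) = pturn (wOut :: l₁ ++ [v]) + turn s v g :=
    pturn_concat_turn (wOut :: l₁) (List.cons_ne_nil _ _) v g
  have e5 : pturn (v :: (h :: r).reverse ++ [v]) = -pturn (v :: h :: r ++ [v]) := by
    rw [← pturn_reverse]; congr 1; simp
  have e6 : cturn (v :: h :: r) = pturn (v :: h :: r ++ [v]) + turn g v h := by
    rw [cturn, show (v :: h :: r).take 2 = [v, h] from rfl,
      pturn_concat_turn (v :: h :: r) (List.cons_ne_nil _ _) v h, hlast]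
  rw [e2, e4, e5, e1, e3]
  linarith [hct, t1, t2, e6]

/-- **The sum over a pair vanishes**, `c(γ₁) + c(γ₂) = (p-v) e^{-iσW(a,p)} x_c^ℓ (j λ̄⁴ + j̄ λ⁴) = 0`,
under the hypotheses `wOut ∉ V` and "every simple cycle of `V` is outside the entrance".
[cite: DuminilCopinSmirnov2012, proof of Lemma 1] -/
theorem pair_sum_of_wnd (hw : wOut ∉ V)
    (h₀ : ∀ c : List HV, (∀ x ∈ c, x ∈ V) → IsCyc c → wnd c (1, 0) = 0)
    {l₁ l₂ : List HV} (hP : IsMidWalk V (lw l₁ v l₂)) :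
    edir v (finalDart (lw l₁ v l₂)).1 * pwt (lw l₁ v l₂) +
      edir v (finalDart (lw l₁ v l₂.reverse)).1 * pwt (lw l₁ v l₂.reverse) = 0 := by
  have h2 := lw_two_le hP
  have hl₂ : l₂ ≠ [] := by rintro rfl; simp at h2
  obtain ⟨hvs, hvh, hvg, hsh, hhg, hsg, -⟩ := lw_nbrs_of_not_mem hw hP hl₂
  have hpt := pturn_lw_rev_of_wnd hw h₀ hP hl₂
  rw [finalDart_lw _ _ hl₂, finalDart_lw _ _ (by simpa using hl₂)]
  simp only [List.getLast_reverse, pwt, mwLen_lw, List.length_reverse, hpt]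
  rcases adj_cases hvs hvh with e | e | e
  · exact absurd e.symm hsh
  · -- first vertex of the loop is `ccw v s`: a right turn, the last one is `cw v s`
    have e' : l₂.getLast hl₂ = cw v (lwS l₁) := by
      rcases adj_cases hvs hvg with e' | e' | e'
      · exact absurd e'.symm hsg
      · exact absurd (e.trans e'.symm) hhg
      · exact e'
    rw [e, e', turn_ccw hvs, edir_ccw hvs, edir_cw hvs,
      show pturn (lw l₁ v l₂) + 8 * -1 = pturn (lw l₁ v l₂) - 8 by ring]
    linear_combination
      ((hexCriticalFugacity : ℂ) ^ (l₁.length + l₂.length + 1) * edir v (lwS l₁)) *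
        pair_identity (pturn (lw l₁ v l₂))
  · -- first vertex of the loop is `cw v s`: a left turn, the last one is `ccw v s`
    have e' : l₂.getLast hl₂ = ccw v (lwS l₁) := by
      rcases adj_cases hvs hvg with e' | e' | e'
      · exact absurd e'.symm hsg
      · exact e'
      · exact absurd (e.trans e'.symm) hhg
    rw [e, e', turn_cw hvs, edir_ccw hvs, edir_cw hvs, mul_one]
    have key := pair_identity (pturn (lw l₁ v l₂) + 8)
    rw [Int.add_sub_cancel] at key
    linear_combination
      ((hexCriticalFugacity : ℂ) ^ (l₁.length + l₂.length + 1) * edir v (lwS l₁)) * key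

/-- **Pairs contribute zero** (the class "three mid-edges" sums to zero by the fixed-point-free
involution `loopRev`), under the hypotheses `wOut ∉ V` and "every simple cycle of `V` is outside
the entrance". [cite: DuminilCopinSmirnov2012, proof of Lemma 1 ("walks visiting the three
mid-edges can be grouped in pairs")] -/
theorem sum_clsLoop_eq_zero_of_wnd (hw : wOut ∉ V)
    (h₀ : ∀ c : List HV, (∀ x ∈ c, x ∈ V) → IsCyc c → wnd c (1, 0) = 0) (v : HV) :
    ∑ P ∈ clsLoop V v, edir v (finalDart P).1 * pwt P = 0 := by
  refine Finset.sum_involution (fun P _ => loopRev v P) (fun P hP => ?_) (fun P hP _ => ?_)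
    (fun P hP => ?_) (fun P hP => ?_)
  · obtain ⟨l₁, l₂, hv₁, rfl⟩ := exists_eq_lw hP
    rw [loopRev_lw hv₁]
    exact pair_sum_of_wnd hw h₀ (mem_midWalks_iff.1 (mem_filter.1 hP).1)
  · obtain ⟨l₁, l₂, hv₁, rfl⟩ := exists_eq_lw hP
    rw [loopRev_lw hv₁]
    exact lw_rev_ne (mem_midWalks_iff.1 (mem_filter.1 hP).1)
  · obtain ⟨l₁, l₂, hv₁, rfl⟩ := exists_eq_lw hP
    have hPw := mem_midWalks_iff.1 (mem_filter.1 hP).1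
    have h2 := lw_two_le hPw
    have hl₂ : l₂.reverse ≠ [] := by
      intro h; rw [List.reverse_eq_nil_iff] at h; subst h; simp at h2
    rw [loopRev_lw hv₁, clsLoop, mem_filter, mem_midWalks_iff, finalDart_lw _ _ hl₂, inner_lw]
    exact ⟨lw_rev_isMidWalk hPw, rfl, by simp⟩
  · obtain ⟨l₁, l₂, hv₁, rfl⟩ := exists_eq_lw hP
    simp only [loopRev_lw hv₁, List.reverse_reverse]

end Pairs

/-! ### Lemma 1 in the coordinate model, general form -/

section VertexRelation

variable {V : Finset HV}

/-- **Duminil-Copin–Smirnov, Lemma 1, coordinate model, general domains**: for every vertex `v`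
of a finite domain `V` not containing the outer end `wOut` of the entrance mid-edge `a` and all
of whose simple cycles have winding number `0` around the face `(1, 0)` adjacent to `a` (this is
what "`a ∈ ∂Ω`, `Ω` simply connected" gives), the contributions `c(γ)` of all self-avoiding walks
`γ ⊂ V` from `a` ending at one of the three mid-edges of `v` sum to zero:
`(p-v)F(p) + (q-v)F(q) + (r-v)F(r) = 0` at `x = x_c`, `σ = 5/8`.
[cite: DuminilCopinSmirnov2012, Lemma 1] -/
theorem vertex_relation_of_wnd (hw : wOut ∉ V)
    (h₀ : ∀ c : List HV, (∀ x ∈ c, x ∈ V) → IsCyc c → wnd c (1, 0) = 0) {v : HV} (hvV : v ∈ V) :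
    ∑ P ∈ midWalks V, cv v P = 0 := by
  rw [sum_cv_eq, sum_clsLoop_eq_zero_of_wnd hw h₀ v, add_zero, add_comm]
  exact sum_clsIn_add_clsOut hw hvV

end VertexRelation

end HV

end Literature.Probability.RandomPlanarGeometry.SAW
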